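import Literature.NumberTheory.EllipticCurves.OpenImageMazurFrobeniusProofs
import Literature.NumberTheory.EllipticCurves.OpenImageMazurProofs
import Literature.NumberTheory.EllipticCurves.QuadraticTwistJInvariantProofs
import Literature.NumberTheory.EllipticCurves.IsogenyQuadraticTwistProofs
import Literature.NumberTheory.EllipticCurves.BSDInvariantsProofs
import Literature.NumberTheory.EllipticCurves.ComplexMultiplicationDeuringFrobeniusProofs
import HarnessLib

/-!
# Transport of `Γ`-stable cyclic subgroups along isomorphisms and quadratic twists;
# a rational isogeny of prime degree out of ANY curve with `j = j(E)` forces a root of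
# `X² − a_ℓ(E)X + ℓ` modulo the degree

Topic `Literature/NumberTheory/EllipticCurves`; theorems only (no definition, no named fact).
The glue between the finite tables of Kenku's theorem (`largePrimeIsogenyJTable`, hypothesis
schema `hT` of `KenkuMinimalLevels.lean`: a rational `p`-isogeny puts `j(E)` in a finite list) and
the kernel-decided Frobenius certificates `RationalIsogenyFrobeniusCertificates*.lean` (which are
about ONE globally minimal model `E_j` per listed `j`):

* `zmultiples_stable_geomPointsEquiv` (and `_symm`) — a point `P ∈ W(K̄)` with
  `σP ∈ ℤP` for all `σ ∈ Γ_K` is carried by a change of variables over `K` to such a point of the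
  same order (`geomPointsEquiv` is `Γ_K`-equivariant);
* `zmultiples_stable_untwistEquiv` — the same along the `K̄`-isomorphism
  `untwistEquiv : V^{(d)}(K̄) ≃ V(K̄)`, which is `Γ_K`-equivariant up to SIGN
  (`untwistEquiv_smul_of_eq`, `untwistEquiv_smul_of_eq_neg`), and `−1` preserves `ℤP`;
* `exists_zmultiples_stable_of_j_eq` — hence for elliptic `W, E` over a field of characteristic
  `0` with `j(W) = j(E) ≠ 0, 1728` (so that `W ≅ E^{(d)}`, Silverman *AEC* X.5.4,
  `exists_variableChange_eq_quadraticTwist_of_j_eq`) every `Γ`-stable cyclic subgroup `ℤP` of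
  `W(K̄)` yields one of `E(K̄)` of the same order;
* `exists_root_of_isogeny_prime_degree_of_j_eq` — over `ℚ`: if some elliptic curve `W` with
  `j(W) = j(E)` (`≠ 0, 1728`) has a `ℚ`-isogeny of prime degree `q`, and `E` is globally minimal
  with good reduction at the prime `ℓ ≠ q`, then `X² − a_ℓ(E)X + ℓ` has a root in `𝔽_q`
  (kernel point ↦ stable line on `E` ↦ isogeny character, `Mazur1978.exists_isogenyCharacter` ↦
  Mazur 1978 Prop. 6.3 (1), `Mazur1978.isogenyCharacter_sq_sub_frobeniusTrace_mul_add_eq_zero`,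
  at an arithmetic Frobenius above `ℓ`, which exists).

With the last theorem a level `N = p·q` of Kenku's case (c) closes from `hT`, the `j`-value of the
model (`norm_num`), its global minimality and good reduction at the witness prime, and the two
certificate lemmas `card_…` (for `a_ℓ`) and `noroot_…`.

## References

* [SilvermanAEC2009] J. H. Silverman, *The Arithmetic of Elliptic Curves*, 2nd ed.: III.3.1(b),
  X.2 Prop. 2.4, X.5 Prop. 5.4 and Cor. 5.4.1 (twists), III.4 (isogenies and their kernels).
* [Mazur1978] B. Mazur, *Rational isogenies of prime degree*, Invent. Math. 44 (1978): §5 p. 148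
  (isogeny character), §6 Prop. 6.3 (1).
* [Kenku1982] M. A. Kenku, J. Number Theory 15 (1982) 199–202, proof of Thm. 1 (case (c)).
-/

noncomputable section

open scoped Classical
open NumberField IsDedekindDomain IsDedekindDomain.HeightOneSpectrum Field
open Literature.NumberTheory.EllipticCurves

universe u

namespace Literature.NumberTheory.EllipticCurves

open _root_.WeierstrassCurve

variable {K : Type u} [Field K]

/-! ### Along a change of variables -/

/-- A `Γ_K`-stable cyclic subgroup `ℤP ⊆ W(K̄)` is carried by a change of variables `C` over `K`
to the `Γ_K`-stable cyclic subgroup `ℤP'`, `P' = geomPointsEquiv W C P`, and `P'` has the order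
of `P` (Silverman, *AEC* III.3.1(b): `C` is an isomorphism over `K`). [folklore] -/
theorem zmultiples_stable_geomPointsEquiv (W : WeierstrassCurve K)
    (C : VariableChange K) (P : W.geomPoints)
    (hst : ∀ σ : absoluteGaloisGroup K, σ • P ∈ AddSubgroup.zmultiples P) :
    (∀ σ : absoluteGaloisGroup K,
        σ • geomPointsEquiv W C P ∈ AddSubgroup.zmultiples (geomPointsEquiv W C P)) ∧
      addOrderOf (geomPointsEquiv W C P) = addOrderOf P := by
  refine ⟨fun σ ↦ ?_, AddEquiv.addOrderOf_eq _ P⟩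
  obtain ⟨k, hk⟩ := AddSubgroup.mem_zmultiples_iff.mp (hst σ)
  rw [← geomPointsEquiv_smul, ← hk, map_zsmul]
  exact AddSubgroup.zsmul_mem_zmultiples _ k

/-- The same for the inverse change of variables: a `Γ_K`-stable `ℤQ ⊆ (C • W)(K̄)` comes from the
`Γ_K`-stable `ℤQ'`, `Q' = (geomPointsEquiv W C)⁻¹ Q`, of the same order. [folklore] -/
theorem zmultiples_stable_geomPointsEquiv_symm (W : WeierstrassCurve K)
    (C : VariableChange K) (Q : (C • W).geomPoints)
    (hst : ∀ σ : absoluteGaloisGroup K, σ • Q ∈ AddSubgroup.zmultiples Q) :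
    (∀ σ : absoluteGaloisGroup K,
        σ • (geomPointsEquiv W C).symm Q ∈ AddSubgroup.zmultiples ((geomPointsEquiv W C).symm Q)) ∧
      addOrderOf ((geomPointsEquiv W C).symm Q) = addOrderOf Q := by
  refine ⟨fun σ ↦ ?_, AddEquiv.addOrderOf_eq _ Q⟩
  obtain ⟨k, hk⟩ := AddSubgroup.mem_zmultiples_iff.mp (hst σ)
  have h : σ • (geomPointsEquiv W C).symm Q = (geomPointsEquiv W C).symm (σ • Q) := by
    apply (geomPointsEquiv W C).injective
    rw [geomPointsEquiv_smul, AddEquiv.apply_symm_apply, AddEquiv.apply_symm_apply]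
  rw [h, ← hk, map_zsmul]
  exact AddSubgroup.zsmul_mem_zmultiples _ k

/-! ### Along a quadratic twist -/

/-- A `Γ_K`-stable cyclic subgroup `ℤQ ⊆ V^{(d)}(K̄)` is carried by the `K̄`-isomorphism
`untwistEquiv : V^{(d)}(K̄) ≃ V(K̄)` to a `Γ_K`-stable cyclic subgroup of `V(K̄)` of the same
order: `σ` commutes with `untwistEquiv` up to the sign `σ(√d)/√d = ±1`
(`untwistEquiv_smul_of_eq`, `untwistEquiv_smul_of_eq_neg`), and `−ℤQ' = ℤQ'`
(Silverman, *AEC* X.2 Prop. 2.4, X.5 Cor. 5.4). [cite: SilvermanAEC2009, X.5 Cor. 5.4] -/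
theorem zmultiples_stable_untwistEquiv [NeZero (2 : K)] (V : WeierstrassCurve K) [V.IsCharNeTwoNF]
    {d : K} (hd : d ≠ 0) (Q : (V.quadraticTwist d).geomPoints)
    (hst : ∀ σ : absoluteGaloisGroup K, σ • Q ∈ AddSubgroup.zmultiples Q) :
    (∀ σ : absoluteGaloisGroup K,
        σ • untwistEquiv V hd Q ∈ AddSubgroup.zmultiples (untwistEquiv V hd Q)) ∧
      addOrderOf (untwistEquiv V hd Q) = addOrderOf Q := by
  refine ⟨fun σ ↦ ?_, AddEquiv.addOrderOf_eq _ Q⟩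
  obtain ⟨k, hk⟩ := AddSubgroup.mem_zmultiples_iff.mp (hst σ)
  rcases map_geomSqrt (show AlgebraicClosure K ≃ₐ[K] AlgebraicClosure K from σ) d with h | h
  · rw [← untwistEquiv_smul_of_eq V hd σ h, ← hk, map_zsmul]
    exact AddSubgroup.zsmul_mem_zmultiples _ k
  · have e : σ • untwistEquiv V hd Q = -(untwistEquiv V hd (σ • Q)) := by
      rw [untwistEquiv_smul_of_eq_neg V hd σ h, neg_neg]
    rw [e, ← hk, map_zsmul, ← neg_zsmul]
    exact AddSubgroup.zsmul_mem_zmultiples _ (-k)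

/-! ### Along `j(W) = j(E)` -/

/-- **`Γ`-stable cyclic subgroups depend only on `j ≠ 0, 1728`.** For elliptic curves `W, E` over
a field of characteristic `0` with `j(W) = j(E)`, `j(E) ≠ 0, 1728`, every point `P ∈ W(K̄)` with
`σP ∈ ℤP` for all `σ ∈ Γ_K` yields a point `P' ∈ E(K̄)` of the same order with `σP' ∈ ℤP'` for
all `σ`: `W ≅_K E₀^{(d)}` for the completed-square model `E₀ = C₀ • E` (Silverman *AEC* X.5.4,
`exists_variableChange_eq_quadraticTwist_of_j_eq`), and one transports along the change of
variables, the untwisting `K̄`-isomorphism (equivariant up to sign) and `C₀⁻¹`.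
[cite: SilvermanAEC2009, X.5 Prop. 5.4 and Cor. 5.4.1] -/
theorem exists_zmultiples_stable_of_j_eq [CharZero K] {W E : WeierstrassCurve K} [W.IsElliptic]
    [E.IsElliptic] (hj : W.j = E.j) (h0 : E.j ≠ 0) (h1728 : E.j ≠ 1728) (P : W.geomPoints)
    (hst : ∀ σ : absoluteGaloisGroup K, σ • P ∈ AddSubgroup.zmultiples P) :
    ∃ P' : E.geomPoints, addOrderOf P' = addOrderOf P ∧
      ∀ σ : absoluteGaloisGroup K, σ • P' ∈ AddSubgroup.zmultiples P' := by
  haveI : NeZero (2 : K) := ⟨two_ne_zero⟩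
  letI : Invertible (2 : K) := invertibleOfNonzero two_ne_zero
  -- the completed-square model `E₀ = E.toCharNeTwoNF • E`
  have hjE₀ : W.j = (E.toCharNeTwoNF • E).j := by rw [variableChange_j, hj]
  have h0' : (E.toCharNeTwoNF • E).j ≠ 0 := by rwa [variableChange_j]
  have h1728' : (E.toCharNeTwoNF • E).j ≠ 1728 := by rwa [variableChange_j]
  -- `C • W = E₀^{(d)}`
  obtain ⟨d, hd, C, hC⟩ := exists_variableChange_eq_quadraticTwist_of_j_eq hjE₀ h0' h1728'
  obtain ⟨hst₁, hord₁⟩ := zmultiples_stable_geomPointsEquiv W C P hst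
  obtain ⟨Q, hQord, hQst⟩ : ∃ Q : ((E.toCharNeTwoNF • E).quadraticTwist d).geomPoints,
      addOrderOf Q = addOrderOf P ∧
        ∀ σ : absoluteGaloisGroup K, σ • Q ∈ AddSubgroup.zmultiples Q := by
    rw [← hC]
    exact ⟨_, hord₁, hst₁⟩
  obtain ⟨hst₂, hord₂⟩ := zmultiples_stable_untwistEquiv (E.toCharNeTwoNF • E) hd Q hQst
  obtain ⟨hst₃, hord₃⟩ := zmultiples_stable_geomPointsEquiv_symm E E.toCharNeTwoNF
    (untwistEquiv (E.toCharNeTwoNF • E) hd Q) hst₂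
  exact ⟨_, by rw [hord₃, hord₂, hQord], hst₃⟩

/-! ### A rational isogeny of prime degree forces a root of `X² − a_ℓX + ℓ` modulo the degree -/

/-- A point of a subgroup of prime cardinality `q` other than `O` has order `q` and generates it.
[folklore] -/
theorem addOrderOf_eq_and_zmultiples_eq_of_card_prime {A : Type*} [AddCommGroup A]
    (H : AddSubgroup A) [Finite H] {q : ℕ} (hq : q.Prime) (hcard : Nat.card H = q) {P : A}
    (hP : P ∈ H) (hP0 : P ≠ 0) : addOrderOf P = q ∧ AddSubgroup.zmultiples P = H := by
  have hord : addOrderOf P = q := by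
    have hdvd : addOrderOf (⟨P, hP⟩ : H) ∣ q := hcard ▸ addOrderOf_dvd_natCard _
    rw [AddSubgroup.addOrderOf_mk] at hdvd
    rcases (Nat.dvd_prime hq).mp hdvd with h1 | h1
    · exact absurd (AddMonoid.addOrderOf_eq_one_iff.mp h1) hP0
    · exact h1
  refine ⟨hord, ?_⟩
  have hle : AddSubgroup.zmultiples P ≤ H := AddSubgroup.zmultiples_le.mpr hP
  haveI : Finite (AddSubgroup.zmultiples P) := Finite.of_injective _ (AddSubgroup.inclusion_injective hle)
  apply AddSubgroup.eq_of_le_of_card_ge hle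
  rw [hcard, Nat.card_zmultiples, hord]

/-- **A rational isogeny of prime degree `q` out of any curve with `j = j(E) ≠ 0, 1728` forces a
root of `X² − a_ℓ(E)X + ℓ` in `𝔽_q`** for every prime `ℓ ≠ q` of good reduction of the globally
minimal model `E`: a non-zero point of the kernel (cyclic of prime order, `Γ_ℚ`-stable since the
isogeny is defined over `ℚ`) gives a `Γ_ℚ`-stable line on `W`, hence on `E`
(`exists_zmultiples_stable_of_j_eq`), hence an isogeny character `r`
(`Mazur1978.exists_isogenyCharacter`, Mazur 1978 §5) with `r(φ)² − a_ℓ r(φ) + ℓ = 0` in `𝔽_q` at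
an arithmetic Frobenius `φ` above `ℓ` (Mazur 1978, Prop. 6.3 (1);
`Mazur1978.isogenyCharacter_sq_sub_frobeniusTrace_mul_add_eq_zero`). This is the statement
refuted by the kernel-decided `noroot_…` lemmas of `RationalIsogenyFrobeniusCertificates*.lean`.
[cite: Mazur1978, §6 Prop. 6.3 (1) (p. 153)] -/
theorem exists_root_of_isogeny_prime_degree_of_j_eq {W W' E : WeierstrassCurve ℚ} [W.IsElliptic]
    [W'.IsElliptic] [E.IsElliptic] [E.IsGloballyMinimal] (ψ : Isogeny W W') {q : ℕ} [Fact q.Prime]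
    (hq : ψ.degree = q) (hj : W.j = E.j) (h0 : E.j ≠ 0) (h1728 : E.j ≠ 1728) (ℓ : ℕ)
    [Fact ℓ.Prime] (hℓq : ℓ ≠ q) (hgood : E.HasGoodReductionAtPrime ℓ) :
    ∃ t : ZMod q, t ^ 2 - (E.frobeniusTrace ℓ : ZMod q) * t + (ℓ : ZMod q) = 0 := by
  have hqp : q.Prime := Fact.out
  have hℓ : ℓ.Prime := Fact.out
  haveI : NeZero q := ⟨hqp.ne_zero⟩
  -- a non-zero kernel point `P`: order `q`, `ker ψ = ℤP`, `Γ_ℚ`-stable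
  set H := ψ.toAddMonoidHom.ker with hH
  have hcard : Nat.card H = q := hq
  obtain ⟨P, hPH, hP0⟩ : ∃ P : W.geomPoints, P ∈ H ∧ P ≠ 0 := by
    have h1 : 1 < Nat.card H := by rw [hcard]; exact hqp.one_lt
    haveI : Nontrivial H := Finite.one_lt_card_iff_nontrivial.mp h1
    obtain ⟨⟨P, hP⟩, hne⟩ := exists_ne (⟨0, H.zero_mem⟩ : H)
    exact ⟨P, hP, fun h ↦ hne (Subtype.ext h)⟩
  obtain ⟨hord, hgen⟩ := addOrderOf_eq_and_zmultiples_eq_of_card_prime H hqp hcard hPH hP0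
  have hst : ∀ σ : absoluteGaloisGroup ℚ, σ • P ∈ AddSubgroup.zmultiples P := fun σ ↦ by
    rw [hgen, hH, AddMonoidHom.mem_ker, Isogeny.coe_toAddMonoidHom, ψ.map_smul]
    rw [hH, AddMonoidHom.mem_ker, Isogeny.coe_toAddMonoidHom] at hPH
    rw [hPH, smul_zero]
  -- transport to `E`
  obtain ⟨P', hord', hst'⟩ := exists_zmultiples_stable_of_j_eq hj h0 h1728 P hst
  rw [hord] at hord'
  -- as a point of `E[q]`
  have hqP' : (q : ℤ) • P' = 0 := by
    rw [natCast_zsmul, ← hord']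
    exact addOrderOf_nsmul_eq_zero P'
  set T : geomTorsion E q := ⟨P', (mem_torsionPoints_iff _ _ P').mpr hqP'⟩ with hT
  have hT0 : T ≠ 0 := fun h ↦ by
    have : P' = 0 := congrArg Subtype.val h
    rw [this, addOrderOf_zero] at hord'
    exact hqp.one_lt.ne' hord'.symm
  have hstT : ∀ σ : absoluteGaloisGroup ℚ, σ • T ∈ AddSubgroup.zmultiples T := fun σ ↦ by
    obtain ⟨k, hk⟩ := AddSubgroup.mem_zmultiples_iff.mp (hst' σ)
    refine AddSubgroup.mem_zmultiples_iff.mpr ⟨k, Subtype.ext ?_⟩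
    simp only [AddSubgroup.torsionBy.coe_smul]
    exact hk
  -- the isogeny character and Prop. 6.3 (1) at an arithmetic Frobenius above `ℓ`
  obtain ⟨r, hr⟩ := Mazur1978.exists_isogenyCharacter E q hT0 hstT
  set v : HeightOneSpectrum (𝓞 ℚ) :=
    (Rat.HeightOneSpectrum.primesEquiv (R := 𝓞 ℚ)).symm ⟨ℓ, hℓ⟩ with hvdef
  have hvℓ : (Rat.HeightOneSpectrum.primesEquiv v : ℕ) = ℓ := by
    rw [hvdef, Equiv.apply_symm_apply]
  have hv : (ℓ : 𝓞 ℚ) ∈ v.asIdeal := by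
    rw [DeuringLadic.natCast_mem_asIdeal_iff v ℓ, hvℓ]
  obtain ⟨𝔓, h𝔓⟩ := v.primesAbove_nonempty
  obtain ⟨φ, hφ⟩ := exists_isArithFrobAt_of_mem_primesAbove_holds (v := v) h𝔓
  exact ⟨_, Mazur1978.isogenyCharacter_sq_sub_frobeniusTrace_mul_add_eq_zero E q ℓ hℓq hgood hT0 hr
    hv h𝔓 hφ⟩

end Literature.NumberTheory.EllipticCurves

end
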